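import Mathlib
import Summits.NavierStokesRegularity.NavierStokesRegularity.Theorems.ExtremalTypeIConstantMinimiserExists
import Summits.NavierStokesRegularity.NavierStokesRegularity.Theses.CoriolisHead
import HarnessLib

/-!
# `CoriolisHead.MinimiserExists` (item stmt-NavierStokesRegularity-22679)

The support `MinimiserExists` of route `CoriolisHead` is, character for character, the support
`MinimiserExists` of route `ExtremalTypeIConstant` (item stmt-NavierStokesRegularity-8217), already
proved in the tree as `extremalTypeIConstant_minimiserExists_proof`
(file `ExtremalTypeIConstantMinimiserExists.lean`; KNSS compactness of the Type-I ancient mild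
class): if some admissible class `A_C` has a nontrivial element then an extremal element exists.
This file closes the new item by that theorem.

HONEST FRAMING: a statement about HYPOTHETICAL Type-I ancient mild solutions; nothing here bears on
NS regularity, and the route's cruxes stay open.
-/

noncomputable section

set_option linter.dupNamespace false

namespace Summit.NavierStokesRegularity.NavierStokesRegularity.Theorems

/-- **Item stmt-NavierStokesRegularity-22679** (`CoriolisHead.MinimiserExists`): the statement of
item stmt-NavierStokesRegularity-8217 read in route `CoriolisHead`, closed by the tree theorem
`extremalTypeIConstant_minimiserExists_proof`.
[cite: KochNadirashviliSereginSverak2009, §6 Lemma 6.1 and Prop. 4.1] -/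
theorem coriolisHead_minimiserExists_proof :
    Summit.NavierStokesRegularity.NavierStokesRegularity.Theses.CoriolisHead.MinimiserExists :=
  extremalTypeIConstant_minimiserExists_proof

end Summit.NavierStokesRegularity.NavierStokesRegularity.Theorems

end
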